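import Summits.BirchSwinnertonDyer.BirchSwinnertonDyer.Theorems.Rank2ObservatoryRank3Semistable
import Summits.BirchSwinnertonDyer.BirchSwinnertonDyer.Theorems.Rank2ObservatoryRank3MinimalTotal
import Literature.NumberTheory.EllipticCurves.SerreOpenImageFinalProofs
import Literature.NumberTheory.EllipticCurves.SupersingularDensityProofs
import Literature.NumberTheory.EllipticCurves.ZywinaCMImageProofs
import Literature.NumberTheory.EllipticCurves.SemistableModPImageFiveProofs
import Literature.NumberTheory.EllipticCurves.NonEisensteinPrimeOfSurjective
import Literature.NumberTheory.EllipticCurves.CMTorsionIrreducibleOrdinaryProofs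
import HarnessLib

/-!
# BirchSwinnertonDyer — rank ≥ 2 observatory: the mod-`p` GALOIS IMAGE of every rank-3 census curve
# (Serre 1972 / 1981, Zywina 2015 — theorems of the tree; Mazur 1978 Thm. 1 as the only named fact)

HONEST FRAMING: per-curve certified theorems and census instruments; no claim on BSD in rank ≥ 2.

Cell `b2b-bsdr2` (run/shared/lean/b2b/bsd-rank2-observatory/), cert-2 = the rank-3 arm, gen 60; ONE
zero-kit, data-free file, kernel-census-index row 53. Every `p`-adic instrument of the observatory in
rank `≥ 2` (Kato's `corank Sel_{p^∞} ≤ ord_T L_p`, the Skinner–Urban / `p`-converse readings, Kolyvagin's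
structure theorems for `Ш`, the height-free `Ш[p^∞] = 0` cells) carries a BIG-IMAGE input at its prime
— `E[p]` irreducible, or `ρ̄_{E,p} : Γ_ℚ → GL₂(𝔽_p)` onto. This file reads that input off the rank-3
census table `rank3Table` (all `9 487` curves of rank `3` and conductor `N < 500 000` in Cremona's table)
BY NAME, from theorems the tree PROVES (axioms `propext`, `Classical.choice`, `Quot.sound` only), keyed
to the two kernel censuses already landed: the CM census (row 48: six CM rows `cmRows`, `9 481` non-CM)
and the semistability census (row 52: `Rank3Row.semistableB`, `4 595` semistable rows).

* **§1 The `4 595` semistable rows — Serre 1972 §5.4 Prop. 21** (= Edixhoven 1997 Prop. 2.1; tree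
  theorem `hasSurjectiveModNGaloisRep_of_hasIrreducibleModPGaloisRep_of_isSemistable`, every prime, the
  row's global minimality from `Rank3Row.isGloballyMinimal_of_mem`): `ρ̄_{E,p}` onto ⇔ `E[p]` irreducible
  (`surjective_iff_irreducible_of_semistableB`), hypothesis-free; granting ONLY Mazur 1978 Thm. 1
  (`hM : mazur_isogeny_irreducible`, a named fact = hypothesis) onto at every prime outside
  `{2,3,5,7,11,13,17,19,37,43,67,163}`, so at every `p > 163` — an EFFECTIVE big-image supply.
* **§2 The `9 481` non-CM rows** (`not_hasCM_of_mem_of_not_mem_cmRows`): Serre's open image theorem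
  (`serre_open_image_holds`) gives `ρ̄_{E,p}` onto — hence `E[p]` irreducible — for all sufficiently
  large `p` (INEFFECTIVE threshold, as in Serre 1972), hypothesis-free
  (`eventually_surjective_of_not_mem_cmRows`); the good supersingular primes have density `0`
  (`serre_supersingular_density_zero_holds`, Serre 1981 §8 Thm. 20); and since the good ordinary primes
  are infinite (`infinite_goodOrdinaryPrimes_holds`) every non-CM row has, beyond every bound, a good
  ordinary prime with onto image (`exists_goodOrdinary_surjective_of_not_mem_cmRows`) — the input prime of
  the ordinary instruments EXISTS on all `9 481` rows, unconditionally.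
* **§3 The `6` CM rows** (`309123a1/a2`, `430336d1/d2`, `471969b1/b2`): `ρ̄_{E,p}` is NOT onto at any
  odd prime (Zywina 2015 Prop. 1.14/1.16, Serre 1972 §4.5; tree theorem
  `forall_not_hasSurjectiveModNGaloisRep_of_hasCM_of_two_lt`), yet `E[p]` is irreducible at every good
  ordinary `p ≥ 5` (`hasIrreducibleModPGaloisRep_of_hasCM_of_five_le`), beyond every bound.
* **§4 THE DICHOTOMY, hypothesis-free**: for `r ∈ rank3Table`, `ρ̄_{E,p}` is onto for all large `p`
  IFF `r ∉ cmRows` IFF `¬ HasCM` (`eventually_surjective_iff_not_mem_cmRows`, `…_iff_not_hasCM`).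
* **§5 Every row**: infinitely many good ordinary primes; granting Mazur Thm. 1 a good ordinary `p > 163`
  with `E[p]` irreducible, and on semistable rows with `ρ̄_{E,p}` onto. **§6 Summary**
  `rank3_galoisImageCensus`. **§7 Row `0` = `5077a1` by name** (`Curve5077a.E`): eventually onto;
  onto ⇔ irreducible at every prime; granting Mazur Thm. 1 onto at every `p > 163` (in print
  `ρ̄_{5077a,p}` is onto for every `p`; the primes `≤ 163` are not certified here).

What is NOT claimed: no value of any Serre threshold `p₀`; no surjectivity at a SPECIFIC prime of a
non-semistable non-CM row (that needs a per-`(E,p)` criterion); Deuring's density `1/2` on the CM rows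
is a theorem of the tree (`deuring_supersingular_density_half_holds`) but is not imported here. Per
curve; NOT a class theorem; no census verdict and no BSD statement is changed by this file.

## References

* J.-P. Serre, Invent. Math. 15 (1972), §4.2 Thm. 2, §4.5, §5.4 Prop. 21. [Serre1972]
* J.-P. Serre, Publ. Math. IHÉS 54 (1981), §8 Thm. 20 and Cor. 2. [Serre1981]
* B. Mazur, Invent. Math. 44 (1978), Thm. 1. [Mazur1978]
* D. Zywina, arXiv:1508.07660 (2015), Prop. 1.14, 1.16. [Zywina2015]
* B. Edixhoven, in Cornell–Silverman–Stevens (1997), Prop. 2.1. [Edixhoven1997]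
* J. E. Cremona, Algorithms for Modular Elliptic Curves (1997), Tables. [CremonaAlgorithms1997]
-/

set_option linter.dupNamespace false
set_option autoImplicit false

-- single-conjunct summit: `Summit.BirchSwinnertonDyer.BirchSwinnertonDyer.…` repeats the name by design
namespace Summit.BirchSwinnertonDyer.BirchSwinnertonDyer.Rank2Observatory

open Literature Literature.NumberTheory.EllipticCurves Literature.NumberTheory.DiophantineGeometry
open WeierstrassCurve
open scoped NumberField

/-! ### §1 Serre 1972 §5.4 Prop. 21 on the semistable rows: irreducible ⇒ surjective (all primes) -/

/-- **On a semistable rank-3 census curve, `E[p]` irreducible ⇒ `ρ̄_{E,p}` surjective, for EVERY prime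
`p`** — Serre 1972 §5.4 Prop. 21 i) (= Edixhoven 1997 Prop. 2.1), a THEOREM of the tree
(`hasSurjectiveModNGaloisRep_of_hasIrreducibleModPGaloisRep_of_isSemistable`), with the row's global
minimality (`Rank3Row.isGloballyMinimal_of_mem`) and semistability (row 52, `isSemistable_ringOfIntegers_of_mem`) discharged by name.
[cite: Serre1972, §5.4 Prop. 21] [cite: Edixhoven1997, Prop. 2.1 (PDF p. 285)] -/
theorem hasSurjectiveModNGaloisRep_of_irreducible_of_semistableB {r : Rank3Row} (hr : r ∈ rank3Table)
    (hs : r.semistableB = true) (p : ℕ) [Fact p.Prime] (hirr : r.curve.HasIrreducibleModPGaloisRep p) :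
    r.curve.HasSurjectiveModNGaloisRep p := by
  haveI := isElliptic_of_mem hr
  haveI := Rank3Row.isGloballyMinimal_of_mem hr
  exact r.curve.hasSurjectiveModNGaloisRep_of_hasIrreducibleModPGaloisRep_of_isSemistable
    (isSemistable_ringOfIntegers_of_mem hr hs) p hirr

/-- **Surjective ⇔ irreducible at every prime, on the semistable rows** (`⇐` Serre's Prop. 21; `⇒` a
surjective image has no stable line, `hasIrreducibleModPGaloisRep_of_hasSurjectiveModNGaloisRep`).
[cite: Serre1972, §5.4 Prop. 21] -/
theorem surjective_iff_irreducible_of_semistableB {r : Rank3Row} (hr : r ∈ rank3Table)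
    (hs : r.semistableB = true) (p : ℕ) [Fact p.Prime] :
    r.curve.HasSurjectiveModNGaloisRep p ↔ r.curve.HasIrreducibleModPGaloisRep p := by
  haveI := isElliptic_of_mem hr
  haveI : NeZero (p : ℚ) := ⟨Nat.cast_ne_zero.mpr (Fact.out : p.Prime).ne_zero⟩
  exact ⟨hasIrreducibleModPGaloisRep_of_hasSurjectiveModNGaloisRep r.curve p,
    hasSurjectiveModNGaloisRep_of_irreducible_of_semistableB hr hs p⟩

/-- **Granting Mazur 1978 Thm. 1** (`hM`, named fact: no rational `p`-isogeny for
`p ∉ {2,3,5,7,11,13,17,19,37,43,67,163}`): on a semistable rank-3 census curve `ρ̄_{E,p}` is surjective at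
every prime outside Mazur's twelve. [cite: Mazur1978, Thm 1] [cite: Serre1972, §5.4 Prop. 21] -/
theorem hasSurjectiveModNGaloisRep_of_semistableB_of_mazur (hM : mazur_isogeny_irreducible)
    {r : Rank3Row} (hr : r ∈ rank3Table) (hs : r.semistableB = true) {p : ℕ} (hp : p.Prime)
    (hnot : p ∉ mazurPrimes) : r.curve.HasSurjectiveModNGaloisRep p := by
  haveI := isElliptic_of_mem hr
  haveI : Fact p.Prime := ⟨hp⟩
  exact hasSurjectiveModNGaloisRep_of_irreducible_of_semistableB hr hs p (hM r.curve p hp hnot)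

/-- In particular (granting Mazur Thm. 1) surjective at EVERY prime `p > 163` — an effective big-image
supply on the `4 595` semistable rows. [cite: Mazur1978, Thm 1] [cite: Serre1972, §5.4 Prop. 21] -/
theorem hasSurjectiveModNGaloisRep_of_semistableB_of_mazur_of_lt (hM : mazur_isogeny_irreducible)
    {r : Rank3Row} (hr : r ∈ rank3Table) (hs : r.semistableB = true) {p : ℕ} (hp : p.Prime)
    (h163 : 163 < p) : r.curve.HasSurjectiveModNGaloisRep p :=
  hasSurjectiveModNGaloisRep_of_semistableB_of_mazur hM hr hs hp (not_mem_mazurPrimes_of_lt h163)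

/-! ### §2 The `9 481` non-CM rows: Serre's open image theorem and density `0` (tree theorems) -/

/-- **Eventual surjectivity, hypothesis-free**: for a rank-3 census curve outside the six `cmRows`,
`ρ̄_{E,p} : Γ_ℚ → Aut(E[p])` is surjective for all sufficiently large primes `p` — Serre's open image
theorem, PROVED in the tree (`serre_open_image_holds`), with `¬ HasCM` from the CM census (row 48).
The threshold is not made effective. [cite: Serre1972, §4.2 Théorème 2] -/
theorem eventually_surjective_of_not_mem_cmRows {r : Rank3Row} (hr : r ∈ rank3Table) (h : r ∉ cmRows) :
    ∃ p₀ : ℕ, ∀ p : ℕ, p.Prime → p₀ ≤ p → r.curve.HasSurjectiveModNGaloisRep p := by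
  haveI := isElliptic_of_mem hr
  exact serre_open_image_holds r.curve (not_hasCM_of_mem_of_not_mem_cmRows hr h)

/-- **Eventually surjective, irreducible and outside Mazur's list**, hypothesis-free (non-CM rows).
[cite: Serre1972, §4.2 Théorème 2] -/
theorem eventually_surjective_irreducible_of_not_mem_cmRows {r : Rank3Row} (hr : r ∈ rank3Table)
    (h : r ∉ cmRows) :
    ∃ p₀ : ℕ, ∀ p : ℕ, p.Prime → p₀ ≤ p →
      r.curve.HasSurjectiveModNGaloisRep p ∧ r.curve.HasIrreducibleModPGaloisRep p ∧ p ∉ mazurPrimes := by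
  haveI := isElliptic_of_mem hr
  obtain ⟨p₁, hp₁⟩ :=
    exists_forall_prime_surjective serre_open_image_holds r.curve (not_hasCM_of_mem_of_not_mem_cmRows hr h)
  refine ⟨p₁, fun p hp hle => ?_⟩
  obtain ⟨hsurj, hnot⟩ := hp₁ p hp hle
  haveI : Fact p.Prime := ⟨hp⟩
  haveI : NeZero (p : ℚ) := ⟨Nat.cast_ne_zero.mpr hp.ne_zero⟩
  exact ⟨hsurj, hasIrreducibleModPGaloisRep_of_hasSurjectiveModNGaloisRep r.curve p hsurj, hnot⟩

/-- **Supersingular primes have density `0` on every non-CM row**, hypothesis-free (Serre 1981 §8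
Thm. 20, PROVED in the tree: `serre_supersingular_density_zero_holds`; the row's model is globally
minimal, `Rank3Row.isGloballyMinimal_of_mem`). [cite: Serre1981, §8 Thm. 20] -/
theorem supersingular_density_zero_of_not_mem_cmRows {r : Rank3Row} (hr : r ∈ rank3Table)
    (h : r ∉ cmRows) :
    haveI := Rank3Row.isGloballyMinimal_of_mem hr
    HasPrimeDensity r.curve.goodSupersingularPrimes 0 := by
  haveI := isElliptic_of_mem hr
  haveI := Rank3Row.isGloballyMinimal_of_mem hr
  exact serre_supersingular_density_zero_holds r.curve (not_hasCM_of_mem_of_not_mem_cmRows hr h)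

/-- **Big-image ordinary primes beyond every bound, hypothesis-free (non-CM rows)**: for every `B`
there is a good ordinary prime `p > B` of `E` at which `ρ̄_{E,p}` is surjective and `E[p]` irreducible
(good ordinary primes are infinite, `infinite_goodOrdinaryPrimes_holds`; surjectivity beyond Serre's
threshold). The input prime of the ordinary `p`-adic instruments exists on all `9 481` rows.
[cite: Serre1972, §4.2 Théorème 2] [cite: Serre1981, §8 Cor. 2] -/
theorem exists_goodOrdinary_surjective_of_not_mem_cmRows {r : Rank3Row} (hr : r ∈ rank3Table)
    (h : r ∉ cmRows) (B : ℕ) :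
    haveI := Rank3Row.isGloballyMinimal_of_mem hr
    ∃ p : ℕ, B < p ∧ p ∈ r.curve.goodOrdinaryPrimes ∧
      r.curve.HasSurjectiveModNGaloisRep p ∧ r.curve.HasIrreducibleModPGaloisRep p := by
  haveI := isElliptic_of_mem hr
  haveI := Rank3Row.isGloballyMinimal_of_mem hr
  obtain ⟨p₀, hp₀⟩ := eventually_surjective_irreducible_of_not_mem_cmRows hr h
  obtain ⟨p, hmem, hgt⟩ := (infinite_goodOrdinaryPrimes_holds r.curve).exists_gt (max p₀ B)
  have hp : p.Prime := by obtain ⟨hp, -, -⟩ := hmem; exact hp.out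
  obtain ⟨hsurj, hirr, -⟩ := hp₀ p hp ((le_max_left _ _).trans hgt.le)
  exact ⟨p, (le_max_right p₀ B).trans_lt hgt, hmem, hsurj, hirr⟩

/-! ### §3 The six CM rows: never surjective at odd `p`, irreducible at good ordinary `p ≥ 5` -/

/-- **On a CM row `ρ̄_{E,p}` is NOT surjective at any odd prime** (the image normalises a Cartan
subgroup; Zywina 2015 Prop. 1.14/1.16, Serre 1972 §4.5 — PROVED in the tree,
`forall_not_hasSurjectiveModNGaloisRep_of_hasCM_of_two_lt`). [cite: Zywina2015, Prop. 1.14 and Prop. 1.16 (§1.9)]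
[cite: Serre1972, §4.5] -/
theorem not_surjective_of_mem_cmRows {r : Rank3Row} (hr : r ∈ cmRows) {p : ℕ} (hp : p.Prime)
    (h2 : 2 < p) : ¬ r.curve.HasSurjectiveModNGaloisRep p := by
  haveI := isElliptic_of_mem (mem_rank3Table_of_mem_cmRows hr)
  exact forall_not_hasSurjectiveModNGaloisRep_of_hasCM_of_two_lt r.curve (hasCM_of_mem_cmRows hr) hp h2

/-- Hence a CM row is NOT eventually surjective. [cite: Zywina2015, Prop. 1.14 and Prop. 1.16 (§1.9)] -/
theorem not_eventually_surjective_of_mem_cmRows {r : Rank3Row} (hr : r ∈ cmRows) :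
    ¬ ∃ p₀ : ℕ, ∀ p : ℕ, p.Prime → p₀ ≤ p → r.curve.HasSurjectiveModNGaloisRep p := by
  rintro ⟨p₀, hp₀⟩
  obtain ⟨p, hle, hp⟩ := Nat.exists_infinite_primes (max p₀ 3)
  exact not_surjective_of_mem_cmRows hr hp (by have := le_max_right p₀ 3; omega)
    (hp₀ p hp ((le_max_left _ _).trans hle))

/-- **On a CM row `E[p]` is irreducible at every good ordinary prime `p ≥ 5`** (Serre 1972 §4.5; tree
theorem `hasIrreducibleModPGaloisRep_of_hasCM_of_five_le`; `a_p` is read on the row's globally minimal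
model, `Rank3Row.isGloballyMinimal_of_mem`). [cite: Serre1972, §4.5] -/
theorem irreducible_of_mem_cmRows_of_goodOrdinary {r : Rank3Row} (hr : r ∈ cmRows) {p : ℕ} (hp5 : 5 ≤ p)
    (hmem : haveI := Rank3Row.isGloballyMinimal_of_mem (mem_rank3Table_of_mem_cmRows hr)
      p ∈ r.curve.goodOrdinaryPrimes) :
    r.curve.HasIrreducibleModPGaloisRep p := by
  haveI := isElliptic_of_mem (mem_rank3Table_of_mem_cmRows hr)
  haveI := Rank3Row.isGloballyMinimal_of_mem (mem_rank3Table_of_mem_cmRows hr)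
  obtain ⟨hp, hgood, hord⟩ := hmem
  exact r.curve.hasIrreducibleModPGaloisRep_of_hasCM_of_five_le (hasCM_of_mem_cmRows hr) p hp5 hgood hord

/-- **Small-image ordinary primes beyond every bound on the CM rows, hypothesis-free**: for every `B` a
good ordinary `p > B` with `E[p]` irreducible and `ρ̄_{E,p}` NOT surjective.
[cite: Serre1972, §4.5] [cite: Serre1981, §8 Cor. 2] -/
theorem exists_goodOrdinary_irreducible_not_surjective_of_mem_cmRows {r : Rank3Row} (hr : r ∈ cmRows)
    (B : ℕ) :
    haveI := Rank3Row.isGloballyMinimal_of_mem (mem_rank3Table_of_mem_cmRows hr)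
    ∃ p : ℕ, B < p ∧ p ∈ r.curve.goodOrdinaryPrimes ∧
      r.curve.HasIrreducibleModPGaloisRep p ∧ ¬ r.curve.HasSurjectiveModNGaloisRep p := by
  haveI := isElliptic_of_mem (mem_rank3Table_of_mem_cmRows hr)
  haveI := Rank3Row.isGloballyMinimal_of_mem (mem_rank3Table_of_mem_cmRows hr)
  obtain ⟨p, hmem, hgt⟩ := (infinite_goodOrdinaryPrimes_holds r.curve).exists_gt (max B 4)
  have hp : p.Prime := by obtain ⟨hp, -, -⟩ := hmem; exact hp.out
  have h5 : 5 ≤ p := by have := le_max_right B 4; omega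
  exact ⟨p, (le_max_left B 4).trans_lt hgt, hmem, irreducible_of_mem_cmRows_of_goodOrdinary hr h5 hmem,
    not_surjective_of_mem_cmRows hr hp (by omega)⟩

/-! ### §4 The dichotomy per row, hypothesis-free -/

/-- **THE GALOIS-IMAGE DICHOTOMY OF THE RANK-3 TABLE**: a rank-3 census curve has surjective mod-`p`
image for all sufficiently large `p` IFF its row is not one of the six `cmRows` — Serre's open image
theorem one way, Zywina's CM non-surjectivity the other, both THEOREMS of the tree; no hypothesis.
[cite: Serre1972, §4.2 Théorème 2 and §4.5] [cite: Zywina2015, Prop. 1.14 and Prop. 1.16 (§1.9)] -/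
theorem eventually_surjective_iff_not_mem_cmRows {r : Rank3Row} (hr : r ∈ rank3Table) :
    (∃ p₀ : ℕ, ∀ p : ℕ, p.Prime → p₀ ≤ p → r.curve.HasSurjectiveModNGaloisRep p) ↔ r ∉ cmRows :=
  ⟨fun h hmem => not_eventually_surjective_of_mem_cmRows hmem h,
    eventually_surjective_of_not_mem_cmRows hr⟩

/-- The same against `HasCM` (row 48: `HasCM ↔ row ∈ cmRows`). [cite: Serre1972, §4.2 Théorème 2 and §4.5] -/
theorem eventually_surjective_iff_not_hasCM {r : Rank3Row} (hr : r ∈ rank3Table) :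
    (∃ p₀ : ℕ, ∀ p : ℕ, p.Prime → p₀ ≤ p → r.curve.HasSurjectiveModNGaloisRep p) ↔ ¬ r.curve.HasCM := by
  rw [eventually_surjective_iff_not_mem_cmRows hr, hasCM_iff_mem_cmRows hr]

/-! ### §5 Every row: ordinary primes; granting Mazur Thm. 1 an effective irreducible / surjective prime -/

/-- **Every rank-3 census curve has infinitely many good ordinary primes**, hypothesis-free (tree
theorem `infinite_goodOrdinaryPrimes_holds`). [cite: Serre1981, §8 Cor. 2] -/
theorem goodOrdinaryPrimes_infinite_of_mem {r : Rank3Row} (hr : r ∈ rank3Table) :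
    haveI := Rank3Row.isGloballyMinimal_of_mem hr
    r.curve.goodOrdinaryPrimes.Infinite := by
  haveI := isElliptic_of_mem hr
  haveI := Rank3Row.isGloballyMinimal_of_mem hr
  exact infinite_goodOrdinaryPrimes_holds r.curve

/-- **Granting Mazur Thm. 1, every row has a good ordinary prime `p > 163` with `E[p]` irreducible**
(an effective irreducible-ordinary prime for the `p`-adic instruments, CM or not).
[cite: Mazur1978, Thm 1] [cite: Serre1981, §8 Cor. 2] -/
theorem exists_goodOrdinary_irreducible_of_mazur (hM : mazur_isogeny_irreducible) {r : Rank3Row}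
    (hr : r ∈ rank3Table) :
    haveI := Rank3Row.isGloballyMinimal_of_mem hr
    ∃ p : ℕ, 163 < p ∧ p ∈ r.curve.goodOrdinaryPrimes ∧ r.curve.HasIrreducibleModPGaloisRep p := by
  haveI := isElliptic_of_mem hr
  haveI := Rank3Row.isGloballyMinimal_of_mem hr
  obtain ⟨p, hmem, hgt⟩ := (infinite_goodOrdinaryPrimes_holds r.curve).exists_gt 163
  have hp : p.Prime := by obtain ⟨hp, -, -⟩ := hmem; exact hp.out
  exact ⟨p, hgt, hmem, hM r.curve p hp (not_mem_mazurPrimes_of_lt hgt)⟩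

/-- **Granting Mazur Thm. 1, every SEMISTABLE row has a good ordinary prime `p > 163` with `ρ̄_{E,p}`
surjective** (§1). [cite: Mazur1978, Thm 1] [cite: Serre1972, §5.4 Prop. 21] -/
theorem exists_goodOrdinary_surjective_of_semistableB_of_mazur (hM : mazur_isogeny_irreducible)
    {r : Rank3Row} (hr : r ∈ rank3Table) (hs : r.semistableB = true) :
    haveI := Rank3Row.isGloballyMinimal_of_mem hr
    ∃ p : ℕ, 163 < p ∧ p ∈ r.curve.goodOrdinaryPrimes ∧ r.curve.HasSurjectiveModNGaloisRep p := by
  haveI := Rank3Row.isGloballyMinimal_of_mem hr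
  obtain ⟨p, hgt, hmem, hirr⟩ := exists_goodOrdinary_irreducible_of_mazur hM hr
  haveI : Fact p.Prime := by obtain ⟨hp, -, -⟩ := hmem; exact hp
  exact ⟨p, hgt, hmem, hasSurjectiveModNGaloisRep_of_irreducible_of_semistableB hr hs p hirr⟩

/-! ### §6 Summary -/

/-- **THE MOD-`p` GALOIS IMAGE OF THE RANK-3 TABLE** (summary; conjuncts 1–3 hypothesis-free, the last
granting Mazur 1978 Thm. 1 only): on `rank3Table` (all `9 487` curves of rank `3` and conductor
`< 500 000`) — on the `4 595` semistable rows surjective ⇔ irreducible at every prime; eventually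
surjective iff not one of the six CM rows; the CM rows are non-semistable and non-surjective at every odd
prime; granting Mazur Thm. 1 the semistable rows are surjective at every `p > 163`. HONEST FRAMING: a
census instrument; no claim on BSD in rank ≥ 2. [cite: Serre1972, §4.2 Théorème 2, §4.5, §5.4 Prop. 21]
[cite: Zywina2015, Prop. 1.14 and Prop. 1.16 (§1.9)] [cite: Mazur1978, Thm 1] -/
theorem rank3_galoisImageCensus :
    (∀ r ∈ rank3Table, r.semistableB = true → ∀ (p : ℕ) [Fact p.Prime],
      r.curve.HasSurjectiveModNGaloisRep p ↔ r.curve.HasIrreducibleModPGaloisRep p) ∧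
    (∀ r ∈ rank3Table,
      (∃ p₀ : ℕ, ∀ p : ℕ, p.Prime → p₀ ≤ p → r.curve.HasSurjectiveModNGaloisRep p) ↔ r ∉ cmRows) ∧
    (∀ r ∈ cmRows,
      ¬ r.curve.IsSemistable ℤ ∧ ∀ p : ℕ, p.Prime → 2 < p → ¬ r.curve.HasSurjectiveModNGaloisRep p) ∧
    (mazur_isogeny_irreducible → ∀ r ∈ rank3Table, r.semistableB = true →
      ∀ p : ℕ, p.Prime → 163 < p → r.curve.HasSurjectiveModNGaloisRep p) :=
  ⟨fun _ hr hs p _ => surjective_iff_irreducible_of_semistableB hr hs p,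
    fun _ hr => eventually_surjective_iff_not_mem_cmRows hr,
    fun _ hr => ⟨not_isSemistable_of_mem_cmRows hr, fun _ hp h2 => not_surjective_of_mem_cmRows hr hp h2⟩,
    fun hM _ hr hs _ hp h163 => hasSurjectiveModNGaloisRep_of_semistableB_of_mazur_of_lt hM hr hs hp h163⟩

/-! ### §7 Row `0` by name: `Curve5077a.E = 5077a1` (`y² + y = x³ − 7x + 6`, `N = 5077` prime) -/

/-- Row `0` is not a CM row (kernel); it passes the semistability test (`rank3Table_row0_semistableB`,
row 52) and its curve is `Curve5077a.E` (`curve_row0_eq`). [cite: CremonaAlgorithms1997, Tables] -/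
theorem rank3Table_row0_not_mem_cmRows :
    (rank3Table[0]'(by rw [rank3Table_length]; decide)) ∉ cmRows := by
  decide +kernel

/-- **`ρ̄_{5077a,p}` is surjective for all sufficiently large `p`**, hypothesis-free (Serre's open image
theorem, proved in the tree; `5077a1` has no CM). [cite: Serre1972, §4.2 Théorème 2] -/
theorem curve5077a_eventually_surjective :
    ∃ p₀ : ℕ, ∀ p : ℕ, p.Prime → p₀ ≤ p → Curve5077a.E.HasSurjectiveModNGaloisRep p := by
  rw [← curve_row0_eq]
  exact eventually_surjective_of_not_mem_cmRows (List.getElem_mem _)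
    rank3Table_row0_not_mem_cmRows

/-- **On `5077a1`, surjective ⇔ irreducible at every prime** (semistable; Serre's Prop. 21), hypothesis-free.
[cite: Serre1972, §5.4 Prop. 21] -/
theorem curve5077a_surjective_iff_irreducible (p : ℕ) [Fact p.Prime] :
    Curve5077a.E.HasSurjectiveModNGaloisRep p ↔ Curve5077a.E.HasIrreducibleModPGaloisRep p := by
  rw [← curve_row0_eq]
  exact surjective_iff_irreducible_of_semistableB (List.getElem_mem _)
    rank3Table_row0_semistableB p

/-- **Granting Mazur Thm. 1, `ρ̄_{5077a,p}` is surjective at every prime `p > 163`** (in print: at every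
`p`; the primes `≤ 163` are not certified here). [cite: Mazur1978, Thm 1] [cite: Serre1972, §5.4 Prop. 21] -/
theorem curve5077a_surjective_of_mazur_of_lt (hM : mazur_isogeny_irreducible) {p : ℕ} (hp : p.Prime)
    (h163 : 163 < p) : Curve5077a.E.HasSurjectiveModNGaloisRep p := by
  rw [← curve_row0_eq]
  exact hasSurjectiveModNGaloisRep_of_semistableB_of_mazur_of_lt hM (List.getElem_mem _)
    rank3Table_row0_semistableB hp h163

end Summit.BirchSwinnertonDyer.BirchSwinnertonDyer.Rank2Observatory
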